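import Summits.ABC.IUTFork.ForkGenuineDepthZeroInflation
import Summits.ABC.IUTFork.LDHSplitBadPrimeWitness
import HarnessLib

/-!
# The fork at [IUTchIII] Corollary 3.12 at a GENUINE input: the EXACT bad-mass criterion along the one-place synthetic family
# at an unramified odd deep prime (skeleton XXVIId-c)

Record-only file (D-0012) of the abc-iut cell (deliverable (a), skeleton seat abc-iut-skel, gen 8); TAKES NO SIDE.
Sequel to `ForkGenuineDepthZeroInflation.lean` (XXVIId-b, p436438: scalar Θ-ideles have ZERO (Ind1)/(Ind2)/hull inflation at an
unramified odd prime). HERE the same computation is run along abc-iut-w5-d018's ONE-PLACE synthetic family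
`ThetaVolumeInput.deepAtPlace p v₀ l N σ` (`LDHSplitBadPrimeWitness.lean`: bad set `S = {v₀}` for ONE place `v₀ | p`, ideles
`p^{j²N}` / `p^N` at `v₀` and `1` at every other place — the family along which abc-iut-c312-3 (`cor312Of_of_badMass_le_third`) and
abc-iut-w5-d018 (`cor312Of_of_badMass_le_half`, `exists_lstar_bound_cor312Of_of_badMass_le`, `fork_both_sides_at_split_prime`) showed
that the CHOICE of `𝕍^bad` puts genuine-completion inputs on either side of the typed inequality, with SUFFICIENT bad-mass conditions).
With the zero-inflation lemma the bad-mass condition becomes EXACT: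

* `iUnion_iota_smul_normalizedPacket_eq_self` (packet algebra): a slot union whose slot scalars are integral and include a `1` is
  `(R_I)^∼` itself; `realPrimePacketWith_negLogThetaAt_eq_of_onePlace` (any shell scalar; `p > 2`, all `K_v` (`v | p`) unramified):
  a Θ-idele equal to `p^{c_i}` at `v₀` and `1` elsewhere has `−|log(Θ)|_p = (1/ℓ⋇)·Σ_i (−c_i·log p)·Pr(v₀)^{i+2}` EXACTLY — a summand is
  `−c_i·log p` on the all-`v₀` tuple (probability `β^{j+1}`, `β := Pr(v₀)`) and `0` on every mixed tuple (the unit slot swallows it);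
* `negLogThetaLoc_nonneg_of_thetaPilot_eq_zero` (any input, any prime carrying no bad place): the summand of `−|log(Θ)|` there is
  `≥ 0` (per-prime free inequality: the bare region `O` lies in the hull of its possible images);
* for the family: `negLogThetaLoc_deepAtPlace_eq_of_unramified` (`= −N·log p·S_l(β)`, `S_l(β) := (1/ℓ⋇)Σ_{j=1}^{ℓ⋇} j²·β^{j+1}`),
  `negAbsLogQ_deepAtPlace` (`−|log(q)| = −N·β·log p`), `otherPrimes_deepAtPlace_nonneg` (the depth-free remainder `c ≥ 0`);
* **`cor312Of_deepAtPlace_iff_of_unramified`** — `Cor312Of (deepAtPlace N) ↔ N·log p·(S_l(β) − β) ≤ c + ((l+5)/4)·log π`, whence the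
  EXACT DICHOTOMY IN THE BAD MASS `β = Pr(v₀)`: **`cor312Of_deepAtPlace_of_le`** (`S_l(β) ≤ β ⟹` the typed inequality holds at EVERY
  depth) and **`exists_not_cor312Of_deepAtPlace_of_lt`** (`β < S_l(β) ⟹` it fails at some depth — in fact beyond an explicit one),
  i.e. **`forall_cor312Of_deepAtPlace_iff`**: `(∀ N ≥ 1, Cor312Of (deepAtPlace N)) ↔ S_l(β) ≤ β`. For `β > 0` the criterion reads
  `(1/ℓ⋇)·Σ_{j=1}^{ℓ⋇} j²·β^{j} ≤ 1` (`l = 5`: `β ≤ (√33 − 1)/8 ≈ 0.593`; every `β ≤ 1/2` qualifies for every `l`, recovering w5-d018; `β = 1`,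
  the only value over a degree-one base, never does: `(l+1)l/12 > 1`).

READING (grammar of `HOME/skel/FORK-REAL-MODEL.md` §4/§9/§10; no side taken): in the sharp real model at an unramified odd prime,
the typed inequality of [IUTchIII] Cor. 3.12 along the one-place family is decided by ONE number, the local mass `β` of the bad place:
the Θ-weight `j²` is paid only on all-bad tuples (mass `β^{j+1}`), the `q`-side is paid with mass `β`, and the indeterminacies add
nothing. HONEST SCOPE: inhabitants of the INPUT TYPE with genuine completions but SYNTHETIC ideles, NOT initial Θ-data of [IUTchI]
Def. 3.1 (there `K = F(E_F[l])` is ramified at the bad places and `𝕍^bad_mod` is a choice, Def. 3.1 (b)); sharp (Ind3), full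
(Ind1)/(Ind2), Mochizuki's container. Nothing here bears on whether [IUTchIII] Thm. 3.11 licenses Cor. 3.12; typed ≠ proved.
PROOF-ONLY file: no definitions, no `Prop` facts. [cite: Mochizuki2012, IUTchIV Prop. 1.2 p. 10, (iv) p. 11, Thm. 1.10 Step (v)–(vii) p. 27–30]
[cite: DupuyHilado2025, §1 (1.1), Def. 3.6.3, §3.3, §3.6, §3.9, §4.11–4.12] [cite: Mochizuki2012, IUTchIII Cor. 3.12 p. 173–174]
[cite: Mochizuki2012, IUTchI Def. 3.1 (b) p. 61] [claim: Mochizuki2012, status: disputed] (v2: doc-only locator fix, (iv) = render p. 11.)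
-/

noncomputable section

open Set Module Literature.IUT.LogVolume NumberField IsDedekindDomain
open scoped Pointwise

namespace Summit.ABC.IUTFork.GenuineContent

/-! ## §1 Packet algebra: a slot union with a unit slot -/

section Packet

variable (p : ℕ) [Fact p.Prime] {ι : Type} [Fintype ι] [DecidableEq ι] [Nonempty ι]
variable (k : ι → Type) [∀ i, NontriviallyNormedField (k i)] [∀ i, NormedAlgebra ℚ_[p] (k i)]
  [∀ i, IsUltrametricDist (k i)] [∀ i, ProperSpace (k i)]

omit [Fintype ι] [Nonempty ι] [∀ i, IsUltrametricDist (k i)] [∀ i, ProperSpace (k i)] in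
/-- **A slot union with INTEGRAL slot scalars one of which is `1` is `(R_I)^∼`**: `⋃_a ι_a(g_a)·(R_I)^∼ = (R_I)^∼` if every
`ι_a(g_a) ∈ (R_I)^∼` and some `g_{a₀} = 1`. [cite: DupuyHilado2025, §3.9, §4.7] -/
theorem iUnion_iota_smul_normalizedPacket_eq_self (g : (i : ι) → k i)
    (hg : ∀ i, iota p k i (g i) ∈ normalizedPacket p k) (h1 : ∃ i, g i = 1) :
    (⋃ i, iota p k i (g i) • (normalizedPacket p k : Set (PacketAlgebra p k))) =
      (normalizedPacket p k : Set (PacketAlgebra p k)) := by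
  refine le_antisymm (Set.iUnion_subset fun i => ?_) ?_
  · rintro _ ⟨y, hy, rfl⟩
    exact (normalizedPacket p k).mul_mem (hg i) hy
  · obtain ⟨i, hi⟩ := h1
    intro x hx
    refine Set.mem_iUnion.mpr ⟨i, ?_⟩
    rw [hi, map_one, one_smul]
    exact hx

omit [Fintype ι] [Nonempty ι] [∀ i, IsUltrametricDist (k i)] [∀ i, ProperSpace (k i)] in
/-- `ι_a(p^c) = p^c ∈ (R_I)^∼`. [cite: DupuyHilado2025, §4.7] -/
theorem iota_algebraMap_pow_mem (i : ι) (c : ℕ) :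
    iota p k i (algebraMap ℚ_[p] (k i) ((p : ℚ_[p]) ^ c)) ∈ normalizedPacket p k := by
  rw [AlgHom.commutes, map_pow, map_natCast]
  exact Subring.pow_mem _ (natCast_mem _ p) c

end Packet

/-! ## §2 A Θ-idele concentrated at one place: `−|log(Θ)|_p` exactly -/

section OnePlace

variable {F : Type} [Field F] [NumberField F]
variable (p : ℕ) [hp : Fact p.Prime] (𝔽 : LocalFields F p)
variable (c : (j : ℕ) → (Fin (j + 1) → placesOver F p) → ℚ_[p]) (hc0 : ∀ j e, c j e ≠ 0)
  (hcσ : ∀ (j : ℕ) (σ : Equiv.Perm (Fin (j + 1))) (e : Fin (j + 1) → placesOver F p), c j (e ∘ σ) = c j e)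

/-- **`−|log(Θ)|_p` for a Θ-idele concentrated at ONE place of an unramified odd prime** (real packet, ANY shell scalar): if `p > 2`,
every `K_v` (`v | p`) is absolutely unramified, and `t_{i,v₀} = p^{c_i}`, `t_{i,v} = 1` for `v ≠ v₀`, then
`−|log(Θ)|_p = (1/ℓ⋇)·Σ_i (−c_i·log p)·Pr(v₀)^{i+2}`: on the all-`v₀` tuple of degree `j = i+1` the slot union is `p^{c_i}·(R_{v⃗})^∼`
(zero inflation, log-volume `−c_i·log p`, weight `Pr(v₀)^{j+1}`); on every other tuple a unit slot makes the slot union `(R_{v⃗})^∼`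
itself (log-volume `0`). [cite: Mochizuki2012, IUTchIV Thm. 1.10 Step (v)–(vi) p. 27–29] [cite: DupuyHilado2025, Def. 3.6.3, §3.6, §4.11–4.12]
[claim: Mochizuki2012, status: disputed] -/
theorem realPrimePacketWith_negLogThetaAt_eq_of_onePlace (hp2 : 2 < p)
    (he : ∀ v : placesOver F p, absRamificationIdx p (𝔽.k v) = 1) (v₀ : placesOver F p) {lstar : ℕ}
    (t : Fin lstar → (v : placesOver F p) → (𝔽.k v)ˣ) (cexp : Fin lstar → ℕ)
    (hbad : ∀ (i : Fin lstar) (v : placesOver F p), v = v₀ →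
      (t i v : 𝔽.k v) = algebraMap ℚ_[p] (𝔽.k v) ((p : ℚ_[p]) ^ cexp i))
    (hgood : ∀ (i : Fin lstar) (v : placesOver F p), v ≠ v₀ → (t i v : 𝔽.k v) = 1) :
    (realPrimePacketWith p 𝔽 c hc0 hcσ).negLogThetaAt lstar t =
      (1 / (lstar : ℝ)) * ∑ i : Fin lstar, -((cexp i : ℝ) * Real.log p) * weight F v₀.1 ^ ((i : ℕ) + 1 + 1) := by
  classical
  -- per summand: `−c_i·log p` on the all-`v₀` tuple, `0` elsewhere
  have hval : ∀ (i : Fin lstar) (e : Fin ((i : ℕ) + 1 + 1) → placesOver F p),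
      (realPrimePacketWith p 𝔽 c hc0 hcσ).logμ ((realPrimePacketWith p 𝔽 c hc0 hcσ).possibleImagesHull
        ((realPrimePacketWith p 𝔽 c hc0 hcσ).pilotRegion t) ((i : ℕ) + 1) e) =
        if (∀ a, e a = v₀) then -((cexp i : ℝ) * Real.log p) else 0 := by
    intro i e
    have hI : 2 ≤ Fintype.card (Fin ((i : ℕ) + 1 + 1)) := by simp
    change packetLogμ p (fun b => 𝔽.k (e b)) (packetHull p (fun b => 𝔽.k (e b))
      ((realPrimePacketWith p 𝔽 c hc0 hcσ).possibleImages
        ((realPrimePacketWith p 𝔽 c hc0 hcσ).pilotRegion t) ((i : ℕ) + 1) e)) = _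
    rw [realPrimePacketWith_possibleImages_pilotRegion_eq p 𝔽 c hc0 hcσ t i e]
    by_cases hall : ∀ a, e a = v₀
    · rw [if_pos hall,
        iUnion_iota_smul_eq_smul_of_eq_algebraMap p (fun b => 𝔽.k (e b)) ((p : ℚ_[p]) ^ cexp i) _
          (fun a => hbad i (e a) (hall a)) _,
        iUnion_indTwo_smul_smul_normalizedPacket_eq p (fun b => 𝔽.k (e b)) hI hp2 (fun b => he (e b)) _,
        ← zpow_natCast, ← ppow_smul_set_eq, packetHull_smul_normalizedPacket,
        packetLogμ_ppow_smul p _ _ (packetAdm_normalizedPacket p _), packetLogμ_normalizedPacket, add_zero]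
      push_cast
      ring
    · rw [if_neg hall]
      obtain ⟨a₁, ha₁⟩ := not_forall.mp hall
      have hunion : (⋃ a : Fin ((i : ℕ) + 1 + 1), iota p (fun b => 𝔽.k (e b)) a (t i (e a) : 𝔽.k (e a)) •
          (normalizedPacket p (fun b => 𝔽.k (e b)) : Set (PacketAlgebra p (fun b => 𝔽.k (e b))))) =
          (normalizedPacket p (fun b => 𝔽.k (e b)) : Set (PacketAlgebra p (fun b => 𝔽.k (e b)))) := by
        refine iUnion_iota_smul_normalizedPacket_eq_self p (fun b => 𝔽.k (e b)) _ (fun a => ?_) ⟨a₁, hgood i (e a₁) ha₁⟩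
        by_cases ha : e a = v₀
        · rw [hbad i (e a) ha]
          exact iota_algebraMap_pow_mem p (fun b => 𝔽.k (e b)) a (cexp i)
        · rw [hgood i (e a) ha, map_one]
          exact Subring.one_mem _
      rw [hunion]
      have h1 := iUnion_indTwo_smul_smul_normalizedPacket_eq p (fun b => 𝔽.k (e b)) hI hp2 (fun b => he (e b)) 1
      rw [one_smul] at h1
      rw [h1, packetHull_normalizedPacket]
      exact packetLogμ_normalizedPacket p _
  -- the weight of the all-`v₀` tuple
  have hW : ∀ (i : Fin lstar),
      ∑ e : Fin ((i : ℕ) + 1 + 1) → placesOver F p,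
        (if (∀ a, e a = v₀) then -((cexp i : ℝ) * Real.log p) else 0) * ∏ b, weight F (e b).1 =
        -((cexp i : ℝ) * Real.log p) * weight F v₀.1 ^ ((i : ℕ) + 1 + 1) := by
    intro i
    rw [Finset.sum_eq_single (fun _ => v₀)]
    · rw [if_pos (fun _ => rfl), Finset.prod_const, Finset.card_univ, Fintype.card_fin]
    · intro e _ hne
      have : ¬ ∀ a, e a = v₀ := fun h => hne (funext h)
      rw [if_neg this, zero_mul]
    · intro h
      exact absurd (Finset.mem_univ _) h
  unfold PrimePacket.negLogThetaAt PrimePacket.lnνLp PrimePacket.lnνTensorPower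
  refine congrArg (fun x : ℝ => (1 / (lstar : ℝ)) * x) (Finset.sum_congr rfl fun i _ => ?_)
  rw [Finset.sum_congr rfl fun e _ => by rw [hval i e], hW i]

end OnePlace

/-! ## §3 A per-prime free inequality: primes carrying no bad place contribute `≥ 0` -/

section Nonneg

variable {F₀ : Type} [Field F₀] [NumberField F₀] {K : Type} [Field K] [NumberField K] [Algebra F₀ K]

/-- **At a prime over which the input has NO bad place, the summand of `−|log(Θ)|` is `≥ 0`**: there the Θ-idele is a unit at every
place, the bare region is `O_{v⃗}` (log-volume `0`), and `O_{v⃗}` lies in the hull of its possible images (monotonicity of `log μ̄`;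
hull admissibility from abc-iut-c312-3's `realPrimePacketWith_exists_content_logμ_possibleImagesHull`). Any input, any shell.
[cite: DupuyHilado2025, Def. 3.6.3, §3.9, §4.10–4.12] -/
theorem negLogThetaLoc_nonneg_of_thetaPilot_eq_zero (I : ThetaVolumeInput F₀ K) {p' : ℕ} (hp' : p'.Prime)
    (hθ : ∀ (i : Fin I.lstar) (v : placesOver F₀ p'), I.X.thetaPilot i v.1 = 0) :
    0 ≤ I.negLogThetaLoc p' := by
  classical
  haveI : Fact p'.Prime := ⟨hp'⟩
  rw [I.negLogThetaLoc_of_prime hp']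
  unfold PrimePacket.negLogThetaAt PrimePacket.lnνLp PrimePacket.lnνTensorPower
  refine mul_nonneg (by positivity) (Finset.sum_nonneg fun i _ => Finset.sum_nonneg fun e _ =>
    mul_nonneg ?_ (Finset.prod_nonneg fun b _ => weight_nonneg F₀ (e b).1))
  -- the bare region: admissible, log-volume `0`
  have hidx : 0 < (i : ℕ) + 1 ∧ (i : ℕ) + 1 - 1 < I.lstar := ⟨Nat.succ_pos _, by simp⟩
  have hbare_adm : (I.packetAt p' hp').adm ((I.packetAt p' hp').pilotRegion (I.tΘ p' hp') ((i : ℕ) + 1) e) := by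
    unfold PrimePacket.pilotRegion
    rw [dif_pos hidx]
    exact (I.packetAt p' hp').peel_adm _ ((I.packetAt p' hp').O_adm _ _)
  have hbare0 : (I.packetAt p' hp').logμ ((I.packetAt p' hp').pilotRegion (I.tΘ p' hp') ((i : ℕ) + 1) e) = 0 := by
    unfold PrimePacket.pilotRegion
    rw [dif_pos hidx, (I.packetAt p' hp').logμ_peel _ ((I.packetAt p' hp').O_adm _ _), (I.packetAt p' hp').logμ_O]
    have h0 : (I.packetAt p' hp').ordv (I.tΘ p' hp' ⟨(i : ℕ) + 1 - 1, hidx.2⟩ (e (Fin.last _))) = 0 :=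
      (I.tΘ_ord p' hp' _ _).trans (hθ _ _)
    rw [h0]
    ring
  obtain ⟨-, -, -, -, hadm, -⟩ := realPrimePacketWith_exists_content_logμ_possibleImagesHull p'
    (I.σ.localFieldFamily p' hp') (mScale p' (I.σ.localFieldFamily p' hp')) (mScale_ne_zero p' (I.σ.localFieldFamily p' hp'))
    (mScale_perm p' (I.σ.localFieldFamily p' hp')) (I.tΘ p' hp') i e
  rw [← hbare0]
  exact (I.packetAt p' hp').logμ_mono hbare_adm hadm
    (((I.packetAt p' hp').subset_possibleImages _ _ _).trans ((I.packetAt p' hp').possibleImages_subset_hull _ _ _))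

end Nonneg

/-! ## §4 The one-place family at an unramified odd deep prime: the EXACT bad-mass criterion -/

section DeepAtPlace

variable {F₀ : Type} [Field F₀] [NumberField F₀] {K : Type} [Field K] [NumberField K] [Algebra F₀ K]
variable (p : ℕ) [hp : Fact p.Prime] (v₀ : placesOver F₀ p) (l : ℕ) (hl : l.Prime) (h5 : 5 ≤ l) (σ : PlaceSection F₀ K)

/-- The one-place Θ-idele at `v₀` as a field element: `p^{j²N}`. [cite: DupuyHilado2025, §3.9] -/
theorem coe_tΘ_deepAtPlace_of_eq (N : ℕ) (hN : 0 < N)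
    (i : Fin (ThetaVolumeInput.deepAtPlace p v₀ l hl h5 N hN σ).lstar) (v : placesOver F₀ p) (hv : v = v₀) :
    ((ThetaVolumeInput.deepAtPlace p v₀ l hl h5 N hN σ).tΘ p hp.out i v).val =
      algebraMap ℚ_[p] (((ThetaVolumeInput.deepAtPlace p v₀ l hl h5 N hN σ).σ.localFieldFamily p hp.out).k v)
        ((p : ℚ_[p]) ^ (((i : ℕ) + 1) ^ 2 * N)) := by
  have hv' : v.1 = v₀.1 := by rw [hv]
  rw [map_pow, map_natCast]
  simp only [ThetaVolumeInput.deepAtPlace, if_pos hv', Units.val_pow_eq_pow_val, LocalFields.primeUnit', Units.val_mk0]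
  rfl

/-- … and `1` at every other place (over `p` or not). [cite: DupuyHilado2025, §3.9] -/
theorem coe_tΘ_deepAtPlace_of_ne (N : ℕ) (hN : 0 < N) {p' : ℕ} (hp' : p'.Prime)
    (i : Fin (ThetaVolumeInput.deepAtPlace p v₀ l hl h5 N hN σ).lstar) (v : placesOver F₀ p') (hv : v.1 ≠ v₀.1) :
    ((ThetaVolumeInput.deepAtPlace p v₀ l hl h5 N hN σ).tΘ p' hp' i v).val = 1 := by
  simp only [ThetaVolumeInput.deepAtPlace, if_neg hv, pow_zero, Units.val_one]
  rfl

/-- **THE DEEP PRIME'S SUMMAND, EXACTLY**: if `p > 2` and every `K_{v̲}` (`v | p`) is absolutely unramified, then for every depth `N`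
`negLogThetaLoc (deepAtPlace p v₀ l N σ) p = −N·log p·(1/ℓ⋇)·Σ_{i<ℓ⋇} (i+1)²·β^{i+2}` with `β = Pr(v₀)` — the Θ-weight `j²` is paid only on
the all-`v₀` tuples; no indeterminacy inflation. [cite: Mochizuki2012, IUTchIV Thm. 1.10 Step (v)–(vi) p. 27–29] [cite: DupuyHilado2025, §3.6, Def. 3.6.3]
[claim: Mochizuki2012, status: disputed] -/
theorem negLogThetaLoc_deepAtPlace_eq_of_unramified (hp2 : 2 < p)
    (hunram : ∀ v : placesOver F₀ p, absRamificationIdx p ((σ.localFieldFamily p hp.out).k v) = 1) (N : ℕ) (hN : 0 < N) :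
    (ThetaVolumeInput.deepAtPlace p v₀ l hl h5 N hN σ).negLogThetaLoc p =
      -((N : ℝ) * Real.log p) * ((1 / (((l - 1) / 2 : ℕ) : ℝ)) *
        ∑ i : Fin ((l - 1) / 2), (((i : ℕ) : ℝ) + 1) ^ 2 * weight F₀ v₀.1 ^ ((i : ℕ) + 1 + 1)) := by
  rw [(ThetaVolumeInput.deepAtPlace p v₀ l hl h5 N hN σ).negLogThetaLoc_of_prime hp.out]
  have h := realPrimePacketWith_negLogThetaAt_eq_of_onePlace p
    ((ThetaVolumeInput.deepAtPlace p v₀ l hl h5 N hN σ).σ.localFieldFamily p hp.out)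
    (mScale p ((ThetaVolumeInput.deepAtPlace p v₀ l hl h5 N hN σ).σ.localFieldFamily p hp.out))
    (mScale_ne_zero p ((ThetaVolumeInput.deepAtPlace p v₀ l hl h5 N hN σ).σ.localFieldFamily p hp.out))
    (mScale_perm p ((ThetaVolumeInput.deepAtPlace p v₀ l hl h5 N hN σ).σ.localFieldFamily p hp.out)) hp2 hunram v₀
    ((ThetaVolumeInput.deepAtPlace p v₀ l hl h5 N hN σ).tΘ p hp.out) (fun i => ((i : ℕ) + 1) ^ 2 * N)
    (fun i v hv => coe_tΘ_deepAtPlace_of_eq p v₀ l hl h5 σ N hN i v hv)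
    (fun i v hv => coe_tΘ_deepAtPlace_of_ne p v₀ l hl h5 σ N hN hp.out i v (fun h => hv (Subtype.ext h)))
  refine h.trans ?_
  change (1 / (((l - 1) / 2 : ℕ) : ℝ)) * ∑ i : Fin ((l - 1) / 2),
    -((((((i : ℕ) + 1) ^ 2 * N : ℕ) : ℕ) : ℝ) * Real.log p) * weight F₀ v₀.1 ^ ((i : ℕ) + 1 + 1) = _
  rw [Finset.mul_sum, Finset.mul_sum, Finset.mul_sum]
  exact Finset.sum_congr rfl fun i _ => by push_cast; ring

/-- At every prime other than the deep one the summand does not move with the depth (the Θ-idele is `1` there).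
[cite: DupuyHilado2025, §3.9, Def. 3.6.3] -/
theorem negLogThetaLoc_deepAtPlace_eq_of_ne (N N' : ℕ) (hN : 0 < N) (hN' : 0 < N') {p' : ℕ} (hp' : p' ≠ p) :
    (ThetaVolumeInput.deepAtPlace p v₀ l hl h5 N hN σ).negLogThetaLoc p' =
      (ThetaVolumeInput.deepAtPlace p v₀ l hl h5 N' hN' σ).negLogThetaLoc p' := by
  by_cases hpr : p'.Prime
  · haveI : Fact p'.Prime := ⟨hpr⟩
    rw [(ThetaVolumeInput.deepAtPlace p v₀ l hl h5 N hN σ).negLogThetaLoc_of_prime hpr,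
      (ThetaVolumeInput.deepAtPlace p v₀ l hl h5 N' hN' σ).negLogThetaLoc_of_prime hpr]
    have ht : (ThetaVolumeInput.deepAtPlace p v₀ l hl h5 N hN σ).tΘ p' hpr =
        (ThetaVolumeInput.deepAtPlace p v₀ l hl h5 N' hN' σ).tΘ p' hpr := by
      funext i v
      have hv : v.1 ≠ v₀.1 := fun h => hp'
        (((mem_placesOver_iff_residueChar v.1).mp v.2).symm.trans (h ▸ (mem_placesOver_iff_residueChar v₀.1).mp v₀.2))
      dsimp only [ThetaVolumeInput.deepAtPlace]
      rw [if_neg hv, if_neg hv]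
    exact congrArg (fun t => ((ThetaVolumeInput.deepAtPlace p v₀ l hl h5 N hN σ).packetAt p' hpr).negLogThetaAt
      ((l - 1) / 2) t) ht
  · rw [ThetaVolumeInput.negLogThetaLoc, ThetaVolumeInput.negLogThetaLoc, dif_neg hpr, dif_neg hpr]

/-- The deep prime is a support prime of the one-place input. [cite: DupuyHilado2025, §3.9] -/
theorem mem_supportPrimes_deepAtPlace (N : ℕ) (hN : 0 < N) :
    p ∈ (ThetaVolumeInput.deepAtPlace p v₀ l hl h5 N hN σ).supportPrimes := by
  have h := (ThetaVolumeInput.deepAtPlace p v₀ l hl h5 N hN σ).residueChar_mem_supportPrimes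
    (v := v₀.1) (Finset.mem_singleton_self _)
  rwa [(mem_placesOver_iff_residueChar v₀.1).mp v₀.2] at h

/-- **The depth-free remainder is `≥ 0`**: every support prime `p' ≠ p` carries no bad place of the one-place input, so its summand is
`≥ 0` (`negLogThetaLoc_nonneg_of_thetaPilot_eq_zero`). [cite: DupuyHilado2025, §4.10–4.12] -/
theorem otherPrimes_deepAtPlace_nonneg (N : ℕ) (hN : 0 < N) :
    0 ≤ ∑ p' ∈ (ThetaVolumeInput.deepAtPlace p v₀ l hl h5 N hN σ).supportPrimes.erase p,
      (ThetaVolumeInput.deepAtPlace p v₀ l hl h5 N hN σ).negLogThetaLoc p' := by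
  classical
  refine Finset.sum_nonneg fun p' hp' => ?_
  have hne : p' ≠ p := Finset.ne_of_mem_erase hp'
  have hpr : p'.Prime :=
    (ThetaVolumeInput.deepAtPlace p v₀ l hl h5 N hN σ).prime_of_mem_supportPrimes (Finset.mem_of_mem_erase hp')
  haveI : Fact p'.Prime := ⟨hpr⟩
  refine negLogThetaLoc_nonneg_of_thetaPilot_eq_zero _ hpr fun i v => ?_
  have hv : v.1 ∉ (ThetaVolumeInput.deepAtPlace p v₀ l hl h5 N hN σ).X.S := by
    rw [ThetaVolumeInput.deepAtPlace_S, Finset.mem_singleton]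
    exact fun h => hne
      (((mem_placesOver_iff_residueChar v.1).mp v.2).symm.trans (h ▸ (mem_placesOver_iff_residueChar v₀.1).mp v₀.2))
  rw [PilotData.thetaPilot_apply', if_neg hv]

/-- **`−|log(q)| = −N·β·log p`** along the one-place family (`β = Pr(v₀)`; `deĝ̲(𝔮) = 2lN·e_{v₀}·f_{v₀}·log p/[F₀:ℚ]`).
[cite: DupuyHilado2025, §3.3, §3.6, Thm. 3.10.1] -/
theorem negAbsLogQ_deepAtPlace (N : ℕ) (hN : 0 < N) :
    (ThetaVolumeInput.deepAtPlace p v₀ l hl h5 N hN σ).negAbsLogQ = -((N : ℝ) * weight F₀ v₀.1 * Real.log p) := by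
  rw [(ThetaVolumeInput.deepAtPlace p v₀ l hl h5 N hN σ).negAbsLogQ_eq,
    ThetaVolumeInput.deepAtPlace_ndeg_qDivisor, logNorm_eq, (mem_placesOver_iff_residueChar v₀.1).mp v₀.2, weight,
    localDegree]
  change -(1 / (2 * (l : ℝ))) * _ = _
  have hl0 : (l : ℝ) ≠ 0 := by exact_mod_cast hl.ne_zero
  have hF : (Module.finrank ℚ F₀ : ℝ) ≠ 0 := by exact_mod_cast Module.finrank_pos.ne'
  push_cast
  field_simp

/-- **THE ONE-PLACE FAMILY, EXACT**: for `p > 2` with every `K_{v̲}` (`v | p`) absolutely unramified, and every depth `N ≥ 1`,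
`Cor312Of (deepAtPlace p v₀ l N σ) ↔ N·log p·(S_l(β) − β) ≤ c + ((l+5)/4)·log π`, where `β = Pr(v₀)`,
`S_l(β) = (1/ℓ⋇)·Σ_{i<ℓ⋇} (i+1)²·β^{i+2}` and `c = Σ_{p' ∈ T∖{p}} negLogThetaLoc (deepAtPlace … 1 …) p' ≥ 0` is depth-free. HYPOTHESIS-shaped
on the left; synthetic input; no side taken. [cite: Mochizuki2012, IUTchIII Cor. 3.12 p. 173–174] [cite: DupuyHilado2025, §1 (1.1), §3.6]
[claim: Mochizuki2012, status: disputed] -/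
theorem cor312Of_deepAtPlace_iff_of_unramified (hp2 : 2 < p)
    (hunram : ∀ v : placesOver F₀ p, absRamificationIdx p ((σ.localFieldFamily p hp.out).k v) = 1) (N : ℕ) (hN : 0 < N) :
    (ThetaVolumeInput.deepAtPlace p v₀ l hl h5 N hN σ).Cor312Of ↔
      ((N : ℝ) * Real.log p) * ((1 / (((l - 1) / 2 : ℕ) : ℝ)) *
          ∑ i : Fin ((l - 1) / 2), (((i : ℕ) : ℝ) + 1) ^ 2 * weight F₀ v₀.1 ^ ((i : ℕ) + 1 + 1) - weight F₀ v₀.1) ≤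
        (∑ p' ∈ (ThetaVolumeInput.deepAtPlace p v₀ l hl h5 1 Nat.one_pos σ).supportPrimes.erase p,
          (ThetaVolumeInput.deepAtPlace p v₀ l hl h5 1 Nat.one_pos σ).negLogThetaLoc p') + ThetaVolumeInput.archLogTheta l := by
  classical
  have hsplit : (ThetaVolumeInput.deepAtPlace p v₀ l hl h5 N hN σ).negLogThetaNonarch =
      (ThetaVolumeInput.deepAtPlace p v₀ l hl h5 N hN σ).negLogThetaLoc p +
        ∑ p' ∈ (ThetaVolumeInput.deepAtPlace p v₀ l hl h5 N hN σ).supportPrimes.erase p,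
          (ThetaVolumeInput.deepAtPlace p v₀ l hl h5 N hN σ).negLogThetaLoc p' :=
    (Finset.add_sum_erase _ _ (mem_supportPrimes_deepAtPlace p v₀ l hl h5 σ N hN)).symm
  have hT : (ThetaVolumeInput.deepAtPlace p v₀ l hl h5 N hN σ).supportPrimes =
      (ThetaVolumeInput.deepAtPlace p v₀ l hl h5 1 Nat.one_pos σ).supportPrimes := rfl
  have hrest : ∑ p' ∈ (ThetaVolumeInput.deepAtPlace p v₀ l hl h5 N hN σ).supportPrimes.erase p,
      (ThetaVolumeInput.deepAtPlace p v₀ l hl h5 N hN σ).negLogThetaLoc p' =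
      ∑ p' ∈ (ThetaVolumeInput.deepAtPlace p v₀ l hl h5 1 Nat.one_pos σ).supportPrimes.erase p,
        (ThetaVolumeInput.deepAtPlace p v₀ l hl h5 1 Nat.one_pos σ).negLogThetaLoc p' := by
    rw [hT]
    exact Finset.sum_congr rfl fun p' hp' =>
      negLogThetaLoc_deepAtPlace_eq_of_ne p v₀ l hl h5 σ N 1 hN Nat.one_pos (Finset.ne_of_mem_erase hp')
  unfold ThetaVolumeInput.Cor312Of ThetaVolumeInput.negLogTheta
  rw [negAbsLogQ_deepAtPlace, hsplit, hrest, negLogThetaLoc_deepAtPlace_eq_of_unramified p v₀ l hl h5 σ hp2 hunram N hN]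
  change _ ≤ _ + ThetaVolumeInput.archLogTheta l ↔ _
  constructor <;> intro h <;> linarith

/-- **TRUE AT EVERY DEPTH when `S_l(β) ≤ β`** (the one-place input then satisfies the typed inequality however deep: the mixed tuples
dominate; recovers abc-iut-w5-d018's `β ≤ 1/2` and abc-iut-c312-3's `β ≤ 1/3` with the exact constant).
[cite: Mochizuki2012, IUTchIII Cor. 3.12 p. 173–174] [claim: Mochizuki2012, status: disputed] -/
theorem cor312Of_deepAtPlace_of_le (hp2 : 2 < p)
    (hunram : ∀ v : placesOver F₀ p, absRamificationIdx p ((σ.localFieldFamily p hp.out).k v) = 1)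
    (hβ : (1 / (((l - 1) / 2 : ℕ) : ℝ)) *
        ∑ i : Fin ((l - 1) / 2), (((i : ℕ) : ℝ) + 1) ^ 2 * weight F₀ v₀.1 ^ ((i : ℕ) + 1 + 1) ≤ weight F₀ v₀.1)
    (N : ℕ) (hN : 0 < N) :
    (ThetaVolumeInput.deepAtPlace p v₀ l hl h5 N hN σ).Cor312Of := by
  rw [cor312Of_deepAtPlace_iff_of_unramified p v₀ l hl h5 σ hp2 hunram N hN]
  have hc := otherPrimes_deepAtPlace_nonneg p v₀ l hl h5 σ 1 Nat.one_pos
  have harch := ThetaVolumeInput.archLogTheta_pos l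
  have hNlog : 0 ≤ (N : ℝ) * Real.log p :=
    mul_nonneg (Nat.cast_nonneg _) (Real.log_nonneg (by exact_mod_cast hp.out.one_lt.le))
  nlinarith

/-- **FALSE BEYOND AN EXPLICIT DEPTH when `β < S_l(β)`** (the deep regime with its exact rate; Archimedes).
[cite: Mochizuki2012, IUTchIII Cor. 3.12 p. 173–174] [claim: Mochizuki2012, status: disputed] -/
theorem exists_not_cor312Of_deepAtPlace_of_lt (hp2 : 2 < p)
    (hunram : ∀ v : placesOver F₀ p, absRamificationIdx p ((σ.localFieldFamily p hp.out).k v) = 1)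
    (hβ : weight F₀ v₀.1 < (1 / (((l - 1) / 2 : ℕ) : ℝ)) *
        ∑ i : Fin ((l - 1) / 2), (((i : ℕ) : ℝ) + 1) ^ 2 * weight F₀ v₀.1 ^ ((i : ℕ) + 1 + 1)) :
    ∃ (N : ℕ) (hN : 0 < N), ¬ (ThetaVolumeInput.deepAtPlace p v₀ l hl h5 N hN σ).Cor312Of := by
  set D : ℝ := (1 / (((l - 1) / 2 : ℕ) : ℝ)) *
      ∑ i : Fin ((l - 1) / 2), (((i : ℕ) : ℝ) + 1) ^ 2 * weight F₀ v₀.1 ^ ((i : ℕ) + 1 + 1) - weight F₀ v₀.1 with hD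
  set C : ℝ := (∑ p' ∈ (ThetaVolumeInput.deepAtPlace p v₀ l hl h5 1 Nat.one_pos σ).supportPrimes.erase p,
      (ThetaVolumeInput.deepAtPlace p v₀ l hl h5 1 Nat.one_pos σ).negLogThetaLoc p') + ThetaVolumeInput.archLogTheta l with hC
  have hDpos : 0 < D := by rw [hD]; linarith
  have hlog : 0 < Real.log p := Real.log_pos (by exact_mod_cast hp.out.one_lt)
  obtain ⟨N, hN⟩ := exists_nat_gt (C / (Real.log p * D))
  refine ⟨N + 1, Nat.succ_pos N, fun h => ?_⟩
  rw [cor312Of_deepAtPlace_iff_of_unramified p v₀ l hl h5 σ hp2 hunram] at h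
  change (((N + 1 : ℕ) : ℝ) * Real.log p) * D ≤ C at h
  have h1 : C < (N : ℝ) * (Real.log p * D) := by rwa [div_lt_iff₀ (mul_pos hlog hDpos)] at hN
  push_cast at h
  nlinarith

/-- **THE EXACT BAD-MASS CRITERION** (one-place family, unramified odd deep prime): the typed inequality of [IUTchIII] Cor. 3.12 holds at
EVERY depth iff `S_l(β) ≤ β`, `S_l(β) = (1/ℓ⋇)·Σ_{i<ℓ⋇} (i+1)²·β^{i+2}`, `β = Pr(v₀)`. (`l = 5`: `β ≤ (√33 − 1)/8`; over a degree-one base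
`β = 1` and the criterion fails for every `l ≥ 5` — abc-iut-w5-d018's `badMass_eq_one_of_finrank_eq_one`.) Synthetic input; no side taken.
[cite: Mochizuki2012, IUTchIII Cor. 3.12 p. 173–174] [cite: Mochizuki2012, IUTchI Def. 3.1 (b) p. 61] [claim: Mochizuki2012, status: disputed] -/
theorem forall_cor312Of_deepAtPlace_iff (hp2 : 2 < p)
    (hunram : ∀ v : placesOver F₀ p, absRamificationIdx p ((σ.localFieldFamily p hp.out).k v) = 1) :
    (∀ (N : ℕ) (hN : 0 < N), (ThetaVolumeInput.deepAtPlace p v₀ l hl h5 N hN σ).Cor312Of) ↔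
      (1 / (((l - 1) / 2 : ℕ) : ℝ)) *
          ∑ i : Fin ((l - 1) / 2), (((i : ℕ) : ℝ) + 1) ^ 2 * weight F₀ v₀.1 ^ ((i : ℕ) + 1 + 1) ≤ weight F₀ v₀.1 := by
  refine ⟨fun h => ?_, fun hβ N hN => cor312Of_deepAtPlace_of_le p v₀ l hl h5 σ hp2 hunram hβ N hN⟩
  by_contra hlt
  obtain ⟨N, hN, hnot⟩ := exists_not_cor312Of_deepAtPlace_of_lt p v₀ l hl h5 σ hp2 hunram (not_le.mp hlt)
  exact hnot (h N hN)

end DeepAtPlace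

end Summit.ABC.IUTFork.GenuineContent

end
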